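import Mathlib.Algebra.Field.ZMod
import Literature.Computability.AlgebraicComplexity.SmallFormatRankLaderman
import HarnessLib

/-!
# The weight of a `3 × 3` matrix multiplication scheme over `ℤ₂` is odd (HKS 2021, §5)

Topic `Literature/Computability/AlgebraicComplexity`, over `matMulTensor` / `triad` of
`MatrixMultiplicationExponent.lean`. Source: M. J. H. Heule, M. Kauers, M. Seidl, *New ways to
multiply `3 × 3`-matrices*, J. Symbolic Comput. 104 (2021), §5 "Simplifying Solutions": "A scheme can
for example be regarded as simpler than another scheme if the number of terms
`α_{i₁,i₂}^{(l)} β_{j₁,j₂}^{(l)} γ_{k₁,k₂}^{(l)}` in it which evaluate to `1` is smaller. Calling this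
number the weight of a scheme, we prefer schemes with smaller weight. … It is clear that the weight is
always odd". Everything here is PROVED; no named facts.

* `schemeWeight α β γ` — HKS's weight of a scheme `(α^{(l)}, β^{(l)}, γ^{(l)})_{l<r}` over `ℤ₂`: the number
  of index tuples `(l, i, j, k)` with `α^{(l)}_i β^{(l)}_j γ^{(l)}_k = 1` (any format `⟨k,m,n⟩`).
* `schemeWeight_cast_eq_sum_entries` — modulo `2` the weight is the sum of all entries of the tensor
  `Σ_l α^{(l)} ⊗ β^{(l)} ⊗ γ^{(l)}` the scheme computes (exchange of summations).
* `heuleKauersSeidl2021_weight_odd` — **"the weight is always odd"**: for every scheme of `⟨3,3,3⟩`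
  over `ℤ₂` (any number `r` of products) the weight is odd, because `⟨3,3,3⟩` has `27` entries equal
  to `1`.

## References

* M. J. H. Heule, M. Kauers, M. Seidl, *New ways to multiply `3 × 3`-matrices*, J. Symbolic Comput.
  104 (2021) 899–916, arXiv:1905.10192, §5 ("It is clear that the weight is always odd").
  [HeuleKauersSeidl2021]
-/

namespace Literature.Computability.AlgebraicComplexity

open scoped BigOperators

section Weight

variable {ι κ μ σ : Type*} [Fintype ι] [Fintype κ] [Fintype μ] [Fintype σ]

/-- **HKS's weight of a scheme over `ℤ₂`:** the number of terms `α^{(l)}_i β^{(l)}_j γ^{(l)}_k`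
(`l` ranging over the products, `i, j, k` over the matrix positions) which evaluate to `1`.
[cite: HeuleKauersSeidl2021, §5 ("Calling this number the weight of a scheme")] -/
def schemeWeight (α : σ → ι → ZMod 2) (β : σ → κ → ZMod 2) (γ : σ → μ → ZMod 2) : ℕ :=
  ∑ l, ∑ i, ∑ j, ∑ k, if α l i * β l j * γ l k = 1 then 1 else 0

/-- In `ℤ₂`, counting the ones of a `{0,1}`-valued function is summing it. [folklore] -/
private theorem ite_eq_one_eq (x : ZMod 2) : (if x = 1 then (1 : ZMod 2) else 0) = x := by
  revert x; decide

/-- **Modulo `2`, the weight is the sum of all entries of the computed tensor**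
`Σ_l α^{(l)} ⊗ β^{(l)} ⊗ γ^{(l)}` (exchange the summations over `l` and over the positions).
[cite: HeuleKauersSeidl2021, §5 ("It is clear that the weight is always odd")] -/
theorem schemeWeight_cast_eq_sum_entries (α : σ → ι → ZMod 2) (β : σ → κ → ZMod 2)
    (γ : σ → μ → ZMod 2) :
    (schemeWeight α β γ : ZMod 2) = ∑ i, ∑ j, ∑ k, (∑ l, triad (α l) (β l) (γ l)) i j k := by
  simp only [schemeWeight, Nat.cast_sum, Nat.cast_ite, Nat.cast_one, Nat.cast_zero, ite_eq_one_eq,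
    Finset.sum_apply, triad_apply]
  -- move the sum over `l` inside
  rw [Finset.sum_comm]
  refine Finset.sum_congr rfl fun i _ => ?_
  rw [Finset.sum_comm]
  refine Finset.sum_congr rfl fun j _ => ?_
  rw [Finset.sum_comm]

/-- Hence, for a scheme computing `t`, the weight is congruent mod `2` to the sum of the entries of
`t`. [cite: HeuleKauersSeidl2021, §5] -/
theorem schemeWeight_cast_eq_of_sum_eq {t : ι → κ → μ → ZMod 2} {α : σ → ι → ZMod 2}
    {β : σ → κ → ZMod 2} {γ : σ → μ → ZMod 2} (h : ∑ l, triad (α l) (β l) (γ l) = t) :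
    (schemeWeight α β γ : ZMod 2) = ∑ i, ∑ j, ∑ k, t i j k := by
  rw [schemeWeight_cast_eq_sum_entries, h]

end Weight

/-- `⟨3,3,3⟩` over `ℤ₂` has an odd number (`27`) of entries equal to `1`. [folklore] -/
private theorem sum_entries_matMulTensor_three :
    ∑ i, ∑ j, ∑ k, matMulTensor (ZMod 2) 3 3 3 i j k = 1 := by
  decide

/-- **HKS §5: "It is clear that the weight is always odd."** For every `3 × 3` matrix multiplication
scheme over `ℤ₂` — any number `r` of products `α^{(l)} ⊗ β^{(l)} ⊗ γ^{(l)}` summing to `⟨3,3,3⟩` (in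
the tree's slots: output pattern, left form, right form) — the number of terms
`α^{(l)}_i β^{(l)}_j γ^{(l)}_k` equal to `1` is odd (mod `2` it is the number `27` of ones of
`⟨3,3,3⟩`). [cite: HeuleKauersSeidl2021, §5] -/
theorem heuleKauersSeidl2021_weight_odd {σ : Type*} [Fintype σ] {α : σ → Fin 3 × Fin 3 → ZMod 2}
    {β : σ → Fin 3 × Fin 3 → ZMod 2} {γ : σ → Fin 3 × Fin 3 → ZMod 2}
    (h : ∑ l, triad (α l) (β l) (γ l) = matMulTensor (ZMod 2) 3 3 3) : Odd (schemeWeight α β γ) := by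
  rw [← ZMod.natCast_eq_one_iff_odd, schemeWeight_cast_eq_of_sum_eq h, sum_entries_matMulTensor_three]

/-- For instance Laderman's scheme (its `23` products read mod `2`,
`SmallFormatRankLaderman.lean`) has odd weight. [cite: HeuleKauersSeidl2021, §5] -/
theorem schemeWeight_laderman_odd :
    Odd (schemeWeight (ladermanW (ZMod 2)) (ladermanU (ZMod 2)) (ladermanV (ZMod 2))) :=
  heuleKauersSeidl2021_weight_odd (matMulTensor_three_eq_sum_laderman (ZMod 2)).symm

/-- … namely weight `219` (kernel evaluation). [cite: HeuleKauersSeidl2021, §5 (weight)] -/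
theorem schemeWeight_laderman :
    schemeWeight (ladermanW (ZMod 2)) (ladermanU (ZMod 2)) (ladermanV (ZMod 2)) = 219 := by
  decide

end Literature.Computability.AlgebraicComplexity
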